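import Literature.Barriers.RiemannHypothesis.TuranPartialSumsSmallN
import HarnessLib

/-!
# Sections of `ζ` beyond `σ = 1`: no zeros of `ζ_9` in `σ ≥ 1` (Spira's table, proved)

Barrier catalogue `Literature/Barriers/RiemannHypothesis/`, companion of `TuranPartialSums.lean` and
`TuranPartialSumsSmallN.lean` (proofs only). With `N ≤ 8` proved there, this file proves the last case
of Spira's "machine proofs that `ζ_N(s)` has no zeros with `σ ≥ 1` for `N ≤ 9`" (Spira 1968, §1/§4,
Table II), so that the named fact `Spira1968_noZeros_le_nine` of `TuranPartialSumsAssembly.lean`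
becomes a theorem (`zetaPartialSum_ne_zero_of_le_nine`).

## The argument

With `a = 2^{−s}`, `b = 3^{−s}`, `β = 1 + a`, `γ = β(1 + a²)`:
`ζ_9 = (b² + βb + γ) + 5^{−s} + 7^{−s}` (`4^{−s} = a²`, `6^{−s} = ab`, `8^{−s} = a³`, `9^{−s} = b²`).
For `N = 9` the terms in `b` no longer factor through `β`, and the crude bound
`|ζ_9| ≥ |γ| − |b||β| − |b|² − |5^{−s}| − |7^{−s}|` FAILS at `σ = 1` (by about `0.001` near
`cos θ₂ ≈ −0.15`). Instead we project on the direction of `γ`: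
`|γ| · |b² + βb + γ| ≥ Re(γ̄ (b² + βb + γ)) = |γ|² + Re T + Re(γ̄ b²)`, `T = γ̄βb`, and the two
`b`-terms are coupled through the identity `γ̄ b² · |γ|²|β|² = T² Λ` with `Λ = β̄(1 + a²)`
(`Re Λ = C > 0`, `|Λ| = |γ|`): writing `T = X + iY`,
`Re(γ̄ b²)|γ|²|β|² = C(X² − Y²) − 2XY·Im Λ ≥ 2CX² − (C + |Im Λ|)|T|²`, `|T|² = |γ|²|β|²|b|²`,
`C + |Im Λ| ≤ (3/2)|γ|`, and `X + 2CX²/(|γ|²|β|²) ≥ −|γ|²|β|²/(8C)`. Hence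
(`nine_core_lower_bound`) `8C |b² + βb + γ| ≥ |γ|(8C − |β|²) − 12 C |b|²`.
With `u = |a| ≤ 1/2`, `ρ = Re a`, one has `|β|² = 1 + u² + 2ρ`, `C = 1 + 2ρ² − u² + ρ(1 + u²)`,
`|γ| ≥ (1 + ρ)(1 − u² + 2ρ²)` (chords of the concave square roots, exact at `ρ = ±u`),
`|b|² ≤ (4/9)u²`, `|5^{−s}| + |7^{−s}| ≤ (24/35)u`, and everything reduces to the positivity on the
triangle `0 ≤ u ≤ 1/2`, `|ρ| ≤ u` of the sextic
`H(u, ρ) = (1 + ρ)(1 − u² + 2ρ²)(8C − |β|²) − 8Cu(2u/3 + 24/35)`, proved as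
`H = h(ρ) + (1/2 − u) Q(u, ρ)` with `Q ≥ 0` and the quintic `h = H(1/2, ·) > 0` on `[−1/2, 1/2]`
(minimum `≈ 0.152` at `ρ ≈ −0.2`).

## References

* [Spira1968] R. Spira, *Zeros of sections of the zeta function. II*, Math. Comp. 22 (1968),
  163–173, §1 and §4 (Table II: `N = 6` to `9`).
* [PlattTrudgian2016] D. J. Platt, T. S. Trudgian, LMS J. Comput. Math. 19 (2016), 37–41, §2.2.
-/

noncomputable section

open Complex ComplexConjugate

namespace Literature.Barriers.RiemannHypothesis

/-! ## The projection bound for `b² + βb + γ` -/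

/-- Real-variable core of the projection bound: from `g‖G‖ ≥ g² + X + R`,
`R g² y² ≥ 2 C X² − (C + E) g² y² n²`, `C + E ≤ (3/2) g`, one gets
`8 C ‖G‖ ≥ g (8C − y²) − 12 C n²`. [folklore] -/
theorem nine_real_core {g y C E X R n NG : ℝ} (hg : 0 < g) (hy : 0 < y) (hC : 0 < C)
    (h1 : g ^ 2 + X + R ≤ g * NG)
    (h2 : 2 * C * X ^ 2 - (C + E) * (g ^ 2 * y ^ 2 * n ^ 2) ≤ R * (g ^ 2 * y ^ 2))
    (h3 : C + E ≤ 3 / 2 * g) :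
    g * (8 * C - y ^ 2) - 12 * C * n ^ 2 ≤ 8 * C * NG := by
  have hgy : 0 < g ^ 2 * y ^ 2 := by positivity
  -- multiply everything by `g² y² > 0` (and `h1` by `8 C g y²`)
  have h1' : 8 * C * y ^ 2 * g * (g ^ 2 + X + R) ≤ 8 * C * y ^ 2 * g * (g * NG) :=
    mul_le_mul_of_nonneg_left h1 (by positivity)
  have h3' : (C + E) * (8 * C * (g ^ 2 * y ^ 2 * n ^ 2)) ≤
      3 / 2 * g * (8 * C * (g ^ 2 * y ^ 2 * n ^ 2)) :=
    mul_le_mul_of_nonneg_right h3 (by positivity)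
  have key : g ^ 2 * y ^ 2 * (g * (8 * C - y ^ 2) - 12 * C * n ^ 2) ≤
      g ^ 2 * y ^ 2 * (8 * C * NG) := by
    nlinarith [sq_nonneg (4 * C * X + g ^ 2 * y ^ 2), h2, h3', h1']
  exact le_of_mul_le_mul_left key hgy

/-- `Re(z² w)` in coordinates. [folklore] -/
theorem re_sq_mul (z w : ℂ) :
    (z ^ 2 * w).re = (z.re ^ 2 - z.im ^ 2) * w.re - 2 * z.re * z.im * w.im := by
  rw [sq, mul_re, mul_re, mul_im]
  ring

/-- **Projection bound.** For complex `a`, `b`, with `β = 1 + a`, `γ = β(1 + a²)` and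
`C = Re(β̄(1 + a²)) > 0`: `8C · |b² + βb + γ| ≥ |γ|(8C − |β|²) − 12 C |b|²`. (Project on the
direction of `γ`; the two `b`-terms are coupled by `γ̄ b² |γ|²|β|² = (γ̄βb)² β̄(1 + a²)`.)
[folklore] -/
theorem nine_core_lower_bound (a b : ℂ) (hC : 0 < (conj (1 + a) * (1 + a ^ 2)).re) :
    ‖(1 + a) * (1 + a ^ 2)‖ * (8 * (conj (1 + a) * (1 + a ^ 2)).re - ‖1 + a‖ ^ 2) -
        12 * (conj (1 + a) * (1 + a ^ 2)).re * ‖b‖ ^ 2 ≤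
      8 * (conj (1 + a) * (1 + a ^ 2)).re * ‖b ^ 2 + (1 + a) * b + (1 + a) * (1 + a ^ 2)‖ := by
  -- name the players as opaque variables with defining equations
  obtain ⟨β, hβ⟩ : ∃ β : ℂ, β = 1 + a := ⟨_, rfl⟩
  obtain ⟨δ, hδ⟩ : ∃ δ : ℂ, δ = 1 + a ^ 2 := ⟨_, rfl⟩
  obtain ⟨Λ, hΛ⟩ : ∃ Λ : ℂ, Λ = conj β * δ := ⟨_, rfl⟩
  obtain ⟨γ, hγ⟩ : ∃ γ : ℂ, γ = β * δ := ⟨_, rfl⟩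
  obtain ⟨G, hG⟩ : ∃ G : ℂ, G = b ^ 2 + β * b + γ := ⟨_, rfl⟩
  obtain ⟨T, hT⟩ : ∃ T : ℂ, T = conj γ * β * b := ⟨_, rfl⟩
  rw [← hβ, ← hδ, ← hΛ] at hC ⊢
  rw [← hγ, ← hG]
  -- non-vanishing
  have hΛ0 : Λ ≠ 0 := by
    intro h; rw [h] at hC; simp at hC
  have hβ0 : β ≠ 0 := by
    intro h; apply hΛ0; rw [hΛ, h]; simp
  have hδ0 : δ ≠ 0 := by
    intro h; apply hΛ0; rw [hΛ, h]; simp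
  have hg : 0 < ‖γ‖ := by rw [hγ]; exact norm_pos_iff.2 (mul_ne_zero hβ0 hδ0)
  have hy : 0 < ‖β‖ := norm_pos_iff.2 hβ0
  have hΛn : ‖Λ‖ = ‖γ‖ := by
    rw [hΛ, hγ, norm_mul, norm_mul, Complex.norm_conj]
  -- (1) `‖γ‖ ‖G‖ ≥ Re(γ̄ G) = ‖γ‖² + Re T + Re(γ̄ b²)`
  have h1 : ‖γ‖ ^ 2 + T.re + (conj γ * b ^ 2).re ≤ ‖γ‖ * ‖G‖ := by
    have e : conj γ * G = conj γ * b ^ 2 + T + conj γ * γ := by rw [hG, hT]; ring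
    have hre : (conj γ * G).re ≤ ‖γ‖ * ‖G‖ := by
      calc (conj γ * G).re ≤ ‖conj γ * G‖ := Complex.re_le_norm _
        _ = ‖γ‖ * ‖G‖ := by rw [norm_mul, Complex.norm_conj]
    rw [e, add_re, add_re, Complex.conj_mul', ← ofReal_pow, ofReal_re] at hre
    linarith
  -- (2) the coupling identity and its real part
  have hid : conj γ * b ^ 2 * (((‖γ‖ ^ 2 : ℝ) : ℂ) * ((‖β‖ ^ 2 : ℝ) : ℂ)) = T ^ 2 * Λ := by
    rw [ofReal_pow, ofReal_pow, ← Complex.conj_mul', ← Complex.conj_mul', hT, hΛ, hγ]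
    simp only [map_mul]
    ring
  have h2re : (conj γ * b ^ 2).re * (‖γ‖ ^ 2 * ‖β‖ ^ 2) =
      (T.re ^ 2 - T.im ^ 2) * Λ.re - 2 * T.re * T.im * Λ.im := by
    have := congrArg Complex.re hid
    rw [← ofReal_mul, re_mul_ofReal] at this
    rw [this, re_sq_mul]
  -- `|T|² = ‖γ‖² ‖β‖² ‖b‖²`
  have hT2 : T.re ^ 2 + T.im ^ 2 = ‖γ‖ ^ 2 * ‖β‖ ^ 2 * ‖b‖ ^ 2 := by
    rw [← Complex.sq_norm_sub_sq_re T, add_sub_cancel, hT, norm_mul, norm_mul, Complex.norm_conj]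
    ring
  -- (3) `Re(γ̄ b²) ‖γ‖²‖β‖² ≥ 2 C X² − (C + |Im Λ|) |T|²`
  have h3 : 2 * Λ.re * T.re ^ 2 - (Λ.re + |Λ.im|) * (‖γ‖ ^ 2 * ‖β‖ ^ 2 * ‖b‖ ^ 2) ≤
      (conj γ * b ^ 2).re * (‖γ‖ ^ 2 * ‖β‖ ^ 2) := by
    rw [h2re, ← hT2]
    have hp : 0 ≤ |Λ.im| + Λ.im := by linarith [neg_abs_le Λ.im]
    have hm : 0 ≤ |Λ.im| - Λ.im := by linarith [le_abs_self Λ.im]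
    nlinarith [mul_nonneg hp (sq_nonneg (T.re - T.im)), mul_nonneg hm (sq_nonneg (T.re + T.im))]
  -- (4) `C + |Im Λ| ≤ (3/2) ‖γ‖`
  have h4 : Λ.re + |Λ.im| ≤ 3 / 2 * ‖γ‖ := by
    have hsq : Λ.re ^ 2 + Λ.im ^ 2 = ‖γ‖ ^ 2 := by
      rw [← Complex.sq_norm_sub_sq_re Λ, add_sub_cancel, hΛn]
    nlinarith [sq_nonneg (Λ.re - |Λ.im|), sq_abs Λ.im, abs_nonneg Λ.im,
      sq_nonneg (Λ.re + |Λ.im| - 3 / 2 * ‖γ‖)]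
  -- (5) conclude with the real-variable core
  exact nine_real_core hg hy hC h1 h3 h4

/-! ## The sextic `H > 0` on the triangle `0 ≤ u ≤ 1/2`, `|ρ| ≤ u` -/

/-- The quintic `h(ρ) = H(1/2, ρ)` is positive for `ρ ≥ −1/2` (minimum `≈ 0.152` at `ρ ≈ −0.2`):
with `t = ρ + 1/5`, `h = 39997/262500 − (29/560)t + t²(14/5 + 143/10500 + (t + 3/10)(32t² +
(32/5)t + 499/50))`. [folklore] -/
theorem nine_h_pos {r : ℝ} (hr : -1 / 2 ≤ r) :
    0 < 283 / 560 + 1501 / 336 * r + 4063 / 210 * r ^ 2 + 75 / 2 * r ^ 3 + 48 * r ^ 4 +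
      32 * r ^ 5 := by
  have ht : 0 ≤ r + 1 / 2 := by linarith
  have hq : 0 < 32 * (r + 1 / 5) ^ 2 + 32 / 5 * (r + 1 / 5) + 499 / 50 := by
    nlinarith [sq_nonneg (r + 1 / 5 + 1 / 10)]
  have hB : 0 ≤ (r + 1 / 2) * (32 * (r + 1 / 5) ^ 2 + 32 / 5 * (r + 1 / 5) + 499 / 50) :=
    mul_nonneg ht hq.le
  nlinarith [mul_nonneg (sq_nonneg (r + 1 / 5)) hB, sq_nonneg (r + 1 / 5),
    sq_nonneg (r + 1 / 5 - 29 / 3136)]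

/-- The quotient `Q(u, ρ) = (H(u, ρ) − H(1/2, ρ))/(1/2 − u)` is non-negative (indeed `≥ 3`) on
`0 ≤ u ≤ 1/2`, `|ρ| ≤ 1/2`: `Q = A₀ + uA₁ + u²A₂ + u³A₃` with `A₀ ≥ 19/2`, `A₁ ≥ 0`,
`A₂, A₃ ≥ −33/2` there. [folklore] -/
theorem nine_Q_nonneg {u r : ℝ} (hu0 : 0 ≤ u) (hu : u ≤ 1 / 2) (hr1 : -1 / 2 ≤ r)
    (hr2 : r ≤ 1 / 2) :
    0 ≤ (3637 / 280 + 2867 / 168 * r + 3497 / 105 * r ^ 2 + 9 * r ^ 3 - 8 * r ^ 4) +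
      u * (2101 / 140 + 9727 / 420 * r + 134 / 3 * r ^ 2 + 18 * r ^ 3 - 16 * r ^ 4) +
      u ^ 2 * (-2657 / 210 + 1607 / 210 * r + 4 * r ^ 2) +
      u ^ 3 * (-43 / 3 + 13 / 3 * r + 8 * r ^ 2) := by
  have hrp : 0 ≤ r + 1 / 2 := by linarith
  have h14 : 0 ≤ 1 / 4 - r ^ 2 := by nlinarith
  have c3 : 0 ≤ r ^ 2 * (r + 1 / 2) := mul_nonneg (sq_nonneg r) hrp
  have c4 : 0 ≤ r ^ 2 * (1 / 4 - r ^ 2) := mul_nonneg (sq_nonneg r) h14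
  have hA0 : 19 / 2 ≤ 3637 / 280 + 2867 / 168 * r + 3497 / 105 * r ^ 2 + 9 * r ^ 3 - 8 * r ^ 4 := by
    nlinarith [c3, c4, sq_nonneg (r + 7 / 22)]
  have hA1 : 0 ≤ 2101 / 140 + 9727 / 420 * r + 134 / 3 * r ^ 2 + 18 * r ^ 3 - 16 * r ^ 4 := by
    nlinarith [c3, c4, sq_nonneg (r + 11 / 30)]
  have hA2 : -33 / 2 ≤ -2657 / 210 + 1607 / 210 * r + 4 * r ^ 2 := by
    nlinarith [sq_nonneg r]
  have hA3 : -33 / 2 ≤ -43 / 3 + 13 / 3 * r + 8 * r ^ 2 := by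
    nlinarith [sq_nonneg r]
  have hu2 : u ^ 2 ≤ 1 / 4 := by nlinarith
  have hu3 : u ^ 3 ≤ 1 / 8 := by nlinarith
  nlinarith [mul_nonneg hu0 hA1, mul_le_mul_of_nonneg_left hA2 (sq_nonneg u),
    mul_le_mul_of_nonneg_left hA3 (pow_nonneg hu0 3)]

/-- **The sextic is positive on the triangle**: for `0 ≤ u ≤ 1/2` and `|ρ| ≤ u`,
`H(u, ρ) = (1 + ρ)(1 − u² + 2ρ²)(8C − (1 + u² + 2ρ)) − 8Cu(2u/3 + 24/35) > 0`,
`C = 1 + 2ρ² − u² + ρ(1 + u²)`; via `H = h(ρ) + (1/2 − u)Q(u, ρ)`. [folklore] -/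
theorem nine_H_pos {u r : ℝ} (hu0 : 0 ≤ u) (hu : u ≤ 1 / 2) (hr1 : -u ≤ r) (hr2 : r ≤ u) :
    0 < (1 + r) * (1 - u ^ 2 + 2 * r ^ 2) *
          (8 * (1 + 2 * r ^ 2 - u ^ 2 + r * (1 + u ^ 2)) - (1 + u ^ 2 + 2 * r)) -
        8 * (1 + 2 * r ^ 2 - u ^ 2 + r * (1 + u ^ 2)) * u * (2 / 3 * u + 24 / 35) := by
  have hh := nine_h_pos (r := r) (by linarith)
  have hQ := nine_Q_nonneg (u := u) (r := r) hu0 hu (by linarith) (by linarith)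
  have hid : (1 + r) * (1 - u ^ 2 + 2 * r ^ 2) *
          (8 * (1 + 2 * r ^ 2 - u ^ 2 + r * (1 + u ^ 2)) - (1 + u ^ 2 + 2 * r)) -
        8 * (1 + 2 * r ^ 2 - u ^ 2 + r * (1 + u ^ 2)) * u * (2 / 3 * u + 24 / 35) =
      (283 / 560 + 1501 / 336 * r + 4063 / 210 * r ^ 2 + 75 / 2 * r ^ 3 + 48 * r ^ 4 +
        32 * r ^ 5) + (1 / 2 - u) *
      ((3637 / 280 + 2867 / 168 * r + 3497 / 105 * r ^ 2 + 9 * r ^ 3 - 8 * r ^ 4) +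
        u * (2101 / 140 + 9727 / 420 * r + 134 / 3 * r ^ 2 + 18 * r ^ 3 - 16 * r ^ 4) +
        u ^ 2 * (-2657 / 210 + 1607 / 210 * r + 4 * r ^ 2) +
        u ^ 3 * (-43 / 3 + 13 / 3 * r + 8 * r ^ 2)) := by
    ring
  rw [hid]
  have : 0 ≤ (1 / 2 - u) *
      ((3637 / 280 + 2867 / 168 * r + 3497 / 105 * r ^ 2 + 9 * r ^ 3 - 8 * r ^ 4) +
        u * (2101 / 140 + 9727 / 420 * r + 134 / 3 * r ^ 2 + 18 * r ^ 3 - 16 * r ^ 4) +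
        u ^ 2 * (-2657 / 210 + 1607 / 210 * r + 4 * r ^ 2) +
        u ^ 3 * (-43 / 3 + 13 / 3 * r + 8 * r ^ 2)) := mul_nonneg (by linarith) hQ
  linarith

/-! ## `N = 9` -/

/-- `9^{−s} = (3^{−s})²`. [folklore] -/
theorem nine_cpow_neg (s : ℂ) : (9 : ℂ) ^ (-s) = ((3 : ℂ) ^ (-s)) ^ 2 := by
  rw [show (9 : ℂ) = ((3 : ℕ) : ℂ) * ((3 : ℕ) : ℂ) by norm_num, natCast_mul_natCast_cpow, sq]
  norm_num

/-- `ζ_9 = (b² + βb + γ) + 5^{−s} + 7^{−s}` with `a = 2^{−s}`, `b = 3^{−s}`, `β = 1 + a`,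
`γ = β(1 + a²)`. [folklore] -/
theorem zetaPartialSum_nine_eq (s : ℂ) :
    zetaPartialSum 9 s = ((3 : ℂ) ^ (-s)) ^ 2 + (1 + (2 : ℂ) ^ (-s)) * (3 : ℂ) ^ (-s) +
      (1 + (2 : ℂ) ^ (-s)) * (1 + ((2 : ℂ) ^ (-s)) ^ 2) + (5 : ℂ) ^ (-s) + (7 : ℂ) ^ (-s) := by
  have h9 : ((8 : ℕ) : ℂ) + 1 = (9 : ℂ) := by norm_num
  rw [show (9 : ℕ) = 8 + 1 from rfl, zetaPartialSum_succ, h9, zetaPartialSum_eight_eq,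
    nine_cpow_neg]
  ring

/-- The quantities of the projection bound in the coordinates `u = |a|`, `ρ = Re a`:
`Re(β̄(1 + a²)) = 1 + 2ρ² − u² + ρ(1 + u²)`, `|β|² = 1 + u² + 2ρ`, and
`|γ| ≥ (1 + ρ)(1 − u² + 2ρ²)` when `u ≤ 1`. [folklore] -/
theorem nine_coordinates (a : ℂ) (ha : ‖a‖ ≤ 1) :
    (conj (1 + a) * (1 + a ^ 2)).re = 1 + 2 * a.re ^ 2 - ‖a‖ ^ 2 + a.re * (1 + ‖a‖ ^ 2) ∧
    ‖1 + a‖ ^ 2 = 1 + ‖a‖ ^ 2 + 2 * a.re ∧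
    (1 + a.re) * (1 - ‖a‖ ^ 2 + 2 * a.re ^ 2) ≤ ‖(1 + a) * (1 + a ^ 2)‖ := by
  have nsq : ∀ z : ℂ, z.re ^ 2 + z.im ^ 2 = ‖z‖ ^ 2 := fun z ↦ by
    rw [← Complex.sq_norm_sub_sq_re z, add_sub_cancel]
  have hu : a.re ^ 2 + a.im ^ 2 = ‖a‖ ^ 2 := nsq a
  refine ⟨?_, ?_, ?_⟩
  · have e : (conj (1 + a) * (1 + a ^ 2)).re =
        (1 + a.re) * (1 + a.re ^ 2 - a.im ^ 2) + 2 * a.re * a.im ^ 2 := by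
      rw [sq, mul_re]
      simp only [conj_re, conj_im, add_re, add_im, one_re, one_im, mul_re, mul_im]
      ring
    rw [e]
    linear_combination (a.re - 1) * hu
  · have e : ‖1 + a‖ ^ 2 = (1 + a.re) ^ 2 + a.im ^ 2 := by
      rw [← nsq]; simp
    rw [e]
    linear_combination hu
  · have hy : 1 + a.re ≤ ‖1 + a‖ := by
      refine le_of_pow_le_pow_left₀ two_ne_zero (norm_nonneg _) ?_
      have e : ‖1 + a‖ ^ 2 = (1 + a.re) ^ 2 + a.im ^ 2 := by
        rw [← nsq]; simp
      rw [e]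
      nlinarith [sq_nonneg a.im]
    have hW0 : 0 ≤ 1 - ‖a‖ ^ 2 + 2 * a.re ^ 2 := by
      nlinarith [sq_nonneg a.re, norm_nonneg a]
    have hW : 1 - ‖a‖ ^ 2 + 2 * a.re ^ 2 ≤ ‖1 + a ^ 2‖ := by
      refine le_of_pow_le_pow_left₀ two_ne_zero (norm_nonneg _) ?_
      have e : ‖1 + a ^ 2‖ ^ 2 = (1 + a.re ^ 2 - a.im ^ 2) ^ 2 + (2 * a.re * a.im) ^ 2 := by
        rw [← nsq, sq a]
        simp only [add_re, add_im, one_re, one_im, mul_re, mul_im]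
        ring
      rw [e, ← hu]
      nlinarith [sq_nonneg (a.re * a.im)]
    rw [norm_mul]
    exact mul_le_mul hy hW hW0 (norm_nonneg _)

/-- **`ζ_9(s) ≠ 0` for `Re s ≥ 1`** (the case `N = 9` of Spira 1968, §4, Table II; proved here by
the projection bound `nine_core_lower_bound` and the sextic `nine_H_pos`). [cite: Spira1968, §4] -/
theorem zetaPartialSum_ne_zero_of_eq_nine {s : ℂ} (hs : 1 ≤ s.re) : zetaPartialSum 9 s ≠ 0 := by
  rw [zetaPartialSum_nine_eq]
  set a : ℂ := (2 : ℂ) ^ (-s) with ha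
  set b : ℂ := (3 : ℂ) ^ (-s) with hb
  set c : ℂ := (5 : ℂ) ^ (-s) with hc
  set d : ℂ := (7 : ℂ) ^ (-s) with hd
  set u : ℝ := (2 : ℝ) ^ (-s.re) with hu
  obtain ⟨hu0, hu2⟩ := two_rpow_neg_pos_le_half hs
  have na : ‖a‖ = u := norm_two_cpow_neg s
  have nb : ‖b‖ ≤ 2 / 3 * u := by
    simpa using norm_natCast_cpow_neg_le (p := 3) (by norm_num) hs
  have nc : ‖c‖ ≤ 2 / 5 * u := by
    simpa using norm_natCast_cpow_neg_le (p := 5) (by norm_num) hs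
  have nd : ‖d‖ ≤ 2 / 7 * u := by
    simpa using norm_natCast_cpow_neg_le (p := 7) (by norm_num) hs
  -- coordinates
  set r : ℝ := a.re with hr
  have hru : |r| ≤ u := by rw [← na]; exact Complex.abs_re_le_norm a
  obtain ⟨hr1, hr2⟩ := abs_le.1 hru
  obtain ⟨eC, ey, hγ⟩ := nine_coordinates a (by linarith)
  rw [na] at eC ey hγ
  set C : ℝ := (conj (1 + a) * (1 + a ^ 2)).re with hCdef
  have hCpos : 0 < C := by rw [eC]; nlinarith
  have h8C : 0 < 8 * C - ‖1 + a‖ ^ 2 := by rw [eC, ey]; nlinarith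
  have hL0 : 0 ≤ (1 + r) * (1 - u ^ 2 + 2 * r ^ 2) := by
    apply mul_nonneg <;> nlinarith
  -- the projection bound
  have hcore := nine_core_lower_bound a b hCpos
  rw [← hCdef] at hcore
  have hG1 : (1 + r) * (1 - u ^ 2 + 2 * r ^ 2) * (8 * C - ‖1 + a‖ ^ 2) - 12 * C * (2 / 3 * u) ^ 2 ≤
      8 * C * ‖b ^ 2 + (1 + a) * b + (1 + a) * (1 + a ^ 2)‖ := by
    have i1 : (1 + r) * (1 - u ^ 2 + 2 * r ^ 2) * (8 * C - ‖1 + a‖ ^ 2) ≤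
        ‖(1 + a) * (1 + a ^ 2)‖ * (8 * C - ‖1 + a‖ ^ 2) :=
      mul_le_mul_of_nonneg_right hγ h8C.le
    have i2 : 12 * C * ‖b‖ ^ 2 ≤ 12 * C * (2 / 3 * u) ^ 2 := by
      have := pow_le_pow_left₀ (norm_nonneg b) nb 2
      nlinarith
    linarith
  -- if `ζ_9(s) = 0`, the core is as small as `|c| + |d|`
  intro h0
  have heq : b ^ 2 + (1 + a) * b + (1 + a) * (1 + a ^ 2) = -(c + d) := by linear_combination h0
  have hG2 : 8 * C * ‖b ^ 2 + (1 + a) * b + (1 + a) * (1 + a ^ 2)‖ ≤ 8 * C * (24 / 35 * u) := by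
    refine mul_le_mul_of_nonneg_left ?_ (by positivity)
    rw [heq, norm_neg]
    calc ‖c + d‖ ≤ ‖c‖ + ‖d‖ := norm_add_le _ _
      _ ≤ 2 / 5 * u + 2 / 7 * u := add_le_add nc nd
      _ = 24 / 35 * u := by ring
  have hH := nine_H_pos hu0.le hu2 hr1 hr2
  rw [eC, ey] at hG1
  rw [eC] at hG2
  nlinarith [hG1, hG2, hH]

/-- **No zeros of `ζ_N` in `σ ≥ 1` for `1 ≤ N ≤ 9`**: Spira's machine proof (Spira 1968, §1/§4)
is now a theorem of the tree (`N ≤ 6` by Turán's multiplier, `N = 7, 8` by the grouped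
estimates, `N = 9` by the projection bound). [cite: Spira1968, §1 and §4] -/
theorem zetaPartialSum_ne_zero_of_le_nine {N : ℕ} (hN1 : 1 ≤ N) (hN9 : N ≤ 9) {s : ℂ}
    (hs : 1 ≤ s.re) : zetaPartialSum N s ≠ 0 := by
  rcases Nat.lt_or_ge N 9 with h | h
  · exact zetaPartialSum_ne_zero_of_le_eight hN1 (by omega) hs
  · rw [show N = 9 by omega]; exact zetaPartialSum_ne_zero_of_eq_nine hs

/-- In particular (Theorem 1.1 (i) of Platt–Trudgian, cases `N ≤ 9`, open half-plane as printed).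
[cite: PlattTrudgian2016, Theorem 1.1] -/
theorem PlattTrudgian2016_thm11_le_nine (N : ℕ) (hN1 : 1 ≤ N) (hN9 : N ≤ 9) (s : ℂ)
    (hs : 1 < s.re) : zetaPartialSum N s ≠ 0 :=
  zetaPartialSum_ne_zero_of_le_nine hN1 hN9 hs.le

end Literature.Barriers.RiemannHypothesis
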